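import Summits.ValiantsHypothesis.ValiantsHypothesis.Theorems.KPlusLogSqLawStaticPathGapCharging
import Summits.ValiantsHypothesis.ValiantsHypothesis.Theorems.KPlusLogSqLawStaticPathTwoChainsSteps

/-!
# Route «KPlusLogSqLaw» — parametric max-weight independent set on a path: THE SILENT-FLIP LAW, the exit of a partner is charged once

HONEST FRAMING.  Helper toward the crux `WeakLifting` (item `stmt-ValiantsHypothesis-19561`, route `KPlusLogSqLaw`, cell `pub-symmetroid`,
seat val-sym-lift-p4 g24, 2026-08-29) on the line of its witness-plan stub `stub_tridiagonalSectorB` (tropical twin of the STATIC tridiagonal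
sector = parametric maximum-weight independent set on a path; located theory `HOME/val-sym-lift-p4/SILENT-FLIP-LAW.md` §3, Claim 2 (iii),
Cases I/II).  Sequel of `…StaticPathTwoChainsSteps` (and of `…StaticPathGapCharging` for the search lemma `exists_step_of_not_iff`).  A TWO-CHAIN PROCESS is a sequence of states `(S k, Lr k, Rr k)`, `k ≤ T` (heights in a
linear order, left/right records with the greedy semantics of offset `e` on the labels `≤ n`, pairwise distinct heights), consecutive states
differing by the adjacent transposition of the pair `x k < y k ≤ n`, which REVERSES its order, each pair acted on at most once (`honce`).
This file proves the one configuration lemma behind the sharpness of the silent-flip law (`false_of_two_claims`): it is impossible that an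
event `(u, z)` at step `t` and an event `(z, v')` at step `t'` (the same label `z` as right end and as left end) are both followed, with
their closed gaps `[u, z]` and `[z, v']` FROZEN (no record-membership change) up to a common step `s` at which `z` leaves the record set,
while neither `u` nor `z` is a left end again in between.  Case `t' < t`: `z`'s right bit is on from `t'+1` to `s`, the exit is a right
flip against `z`'s nearest right record `y₀ > v'` at `s`, `v'` lost its right bit at a left-event of its own and so was a left record since
`t'+1`, making `(z, v')` a pair creation with opposite parities — and then the heights of `z`, `v'`, `y₀` at `s` force `v'` to be a right
record at `s`, which it is not.  Case `t < t'`: mirror through the left chain (`(u, z)` was a creation, the exit is a left flip against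
`x₀ < u`, and `u` would have to be a left record at `s`).  Pure finite combinatorics; nothing here asserts anything about `WeakLifting`,
`TropicalB`, `KPlusLogSqLaw`, the stub in its window, `MatrixDescartes` (stmt-ValiantsHypothesis-18050) or `VP ≠ VNP`; the ORDER QUESTION
stays open.
-/

set_option linter.dupNamespace false
set_option autoImplicit false

namespace Summit.ValiantsHypothesis.ValiantsHypothesis.Theorems.KPlusLogSqLaw

open Finset Classical

namespace StaticPathFold

section Cases

variable {β : Type*} [LinearOrder β]

/-- **THE EXIT OF A PARTNER IS CHARGED ONCE** (`HOME/val-sym-lift-p4/SILENT-FLIP-LAW.md` §3, Claim 2 (iii), Cases I and II). [folklore] -/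
theorem false_of_two_claims (S : ℕ → ℕ → β) (e n T : ℕ) (x y : ℕ → ℕ) {Lr Rr : ℕ → ℕ → Prop}
    (hxy : ∀ k, k < T → x k < y k ∧ y k ≤ n)
    (hL0 : ∀ k, k ≤ T → Lr k 0) (hRn : ∀ k, k ≤ T → Rr k n)
    (hSem : ∀ k, k ≤ T → ∀ p u, p < u → u ≤ n → Lr k p → (∀ q, p < q → q < u → ¬ Lr k q) →
      (Lr k u ↔ ((Even (u + e) → S k u < S k p) ∧ (¬ Even (u + e) → S k p < S k u))))
    (hSemR : ∀ k, k ≤ T → ∀ u r, u < r → r ≤ n → Rr k r → (∀ q, u < q → q < r → ¬ Rr k q) →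
      (Rr k u ↔ ((Even (u + e) → S k u < S k r) ∧ (¬ Even (u + e) → S k r < S k u))))
    (hord : ∀ k, k < T → ∀ p q, p ≤ n → q ≤ n → ¬(p = x k ∧ q = y k) → ¬(p = y k ∧ q = x k) →
      (S k p < S k q ↔ S (k + 1) p < S (k + 1) q))
    (hdis : ∀ k, k ≤ T → ∀ p q, p ≤ n → q ≤ n → p ≠ q → S k p ≠ S k q)
    (hadj : ∀ k, k < T → ∀ q, q ≤ n → q ≠ x k → q ≠ y k → (S k q < S k (x k) ↔ S k q < S k (y k)))
    (hflip : ∀ k, k < T → (S k (x k) < S k (y k) ↔ ¬ S (k + 1) (x k) < S (k + 1) (y k)))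
    (honce : ∀ k, k < T → ∀ k', k' < T → x k = x k' → y k = y k' → k = k')
    {t t' s : ℕ} (hts : t < s) (ht's : t' < s) (hsT : s < T) (htt' : t ≠ t') (hzz : x t' = y t)
    (hEt : Lr t (x t) ∧ Rr t (y t) ∧ ∀ q, x t < q → q < y t → ¬ Lr t q ∧ ¬ Rr t q)
    (hEt' : Lr t' (x t') ∧ Rr t' (y t') ∧ ∀ q, x t' < q → q < y t' → ¬ Lr t' q ∧ ¬ Rr t' q)
    (hfr : ∀ τ, t ≤ τ → τ ≤ s → ∀ w, x t ≤ w → w ≤ y t → ((Lr τ w ∨ Rr τ w) ↔ (Lr t w ∨ Rr t w)))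
    (hfr' : ∀ τ, t' ≤ τ → τ ≤ s → ∀ w, x t' ≤ w → w ≤ y t' → ((Lr τ w ∨ Rr τ w) ↔ (Lr t' w ∨ Rr t' w)))
    (hnx : ∀ k, t < k → k ≤ s → (Lr k (x k) ∧ Rr k (y k) ∧ ∀ q, x k < q → q < y k → ¬ Lr k q ∧ ¬ Rr k q) → x k ≠ x t)
    (hnx' : ∀ k, t' < k → k ≤ s → (Lr k (x k) ∧ Rr k (y k) ∧ ∀ q, x k < q → q < y k → ¬ Lr k q ∧ ¬ Rr k q) → x k ≠ x t')
    (hexit : ¬ Lr (s + 1) (y t) ∧ ¬ Rr (s + 1) (y t)) :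
    False := by
  -- names: `u = x t`, `z = y t = x t'`, `v' = y t'`
  obtain ⟨huz, hzn⟩ := hxy t (by omega)
  obtain ⟨hzv, hvn⟩ := hxy t' (by omega)
  rw [hzz] at hzv
  have hun : x t ≤ n := by omega
  obtain ⟨hLu, hRz, hgap⟩ := hEt
  obtain ⟨hLz', hRv', hgap'⟩ := hEt'
  rw [hzz] at hLz' hgap'
  /- ### step lemmas instantiated along the process -/
  have hLfl : ∀ k, k < T → ∀ w, w ≤ n → ¬ (Lr (k + 1) w ↔ Lr k w) →
      w = y k ∧ (Lr k (x k) ∧ ∀ q, x k < q → q < y k → ¬ Lr k q) ∧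
        (Lr (k + 1) (x k) ∧ ∀ q, x k < q → q < y k → ¬ Lr (k + 1) q) ∧ (Rr k (y k) → ∀ q, x k < q → q < y k → ¬ Rr k q) :=
    fun k hk w hw hch => left_flip_cases (S k) (S (k + 1)) e n (x k) (y k) (hxy k hk).1 (hxy k hk).2 (hL0 k hk.le)
      (hL0 (k + 1) (by omega)) (hSem k hk.le) (hSem (k + 1) (by omega)) (hSemR k hk.le) (hord k hk) (hdis k hk.le) (hadj k hk) hw hch
  have hRfl : ∀ k, k < T → ∀ w, w ≤ n → ¬ (Rr (k + 1) w ↔ Rr k w) →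
      w = x k ∧ (Rr k (y k) ∧ ∀ q, x k < q → q < y k → ¬ Rr k q) ∧
        (Rr (k + 1) (y k) ∧ ∀ q, x k < q → q < y k → ¬ Rr (k + 1) q) ∧ (Lr k (x k) → ∀ q, x k < q → q < y k → ¬ Lr k q) :=
    fun k hk w hw hch => right_flip_cases (S k) (S (k + 1)) e n (x k) (y k) (hxy k hk).1 (hxy k hk).2 (hRn k hk.le)
      (hRn (k + 1) (by omega)) (hSem k hk.le) (hSemR k hk.le) (hSemR (k + 1) (by omega)) (hord k hk) (hdis k hk.le) (hadj k hk) hw hch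
  have hEvf : ∀ k, k < T → (Lr k (x k) ∧ Rr k (y k) ∧ ∀ q, x k < q → q < y k → ¬ Lr k q ∧ ¬ Rr k q) →
      (Lr (k + 1) (y k) ↔ ¬ Lr k (y k)) ∧ (Rr (k + 1) (x k) ↔ ¬ Rr k (x k)) ∧ Lr (k + 1) (x k) ∧ Rr (k + 1) (y k) :=
    fun k hk hev => event_flips (S k) (S (k + 1)) e n (x k) (y k) (hxy k hk).1 (hxy k hk).2 (hL0 k hk.le) (hL0 (k + 1) (by omega))
      (hRn k hk.le) (hRn (k + 1) (by omega)) (hSem k hk.le) (hSem (k + 1) (by omega)) (hSemR k hk.le) (hSemR (k + 1) (by omega))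
      (hord k hk) (hdis k hk.le) (hdis (k + 1) (by omega)) (hadj k hk) (hflip k hk) hev.1 (fun q h1 h2 => (hev.2.2 q h1 h2).1) hev.2.1
      (fun q h1 h2 => (hev.2.2 q h1 h2).2)
  -- (F4): a bit flip is an event at that label's end or a membership change
  have hLsil : ∀ k, k < T → ∀ w, w ≤ n → ¬ (Lr (k + 1) w ↔ Lr k w) →
      (w = y k ∧ Lr k (x k) ∧ Rr k (y k) ∧ ∀ q, x k < q → q < y k → ¬ Lr k q ∧ ¬ Rr k q) ∨
        ¬ ((Lr (k + 1) w ∨ Rr (k + 1) w) ↔ (Lr k w ∨ Rr k w)) := by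
    intro k hk w hw hch
    obtain ⟨hwy, ⟨hLx, hnoL⟩, -, hR⟩ := hLfl k hk w hw hch
    by_cases hRw : Rr k w
    · left
      refine ⟨hwy, hLx, hwy ▸ hRw, fun q h1 h2 => ⟨hnoL q h1 h2, hR (hwy ▸ hRw) q h1 h2⟩⟩
    · right
      have hRw' : ¬ Rr (k + 1) w := by
        intro h
        have hch' : ¬ (Rr (k + 1) w ↔ Rr k w) := fun hiff => hRw (hiff.mp h)
        have := (hRfl k hk w hw hch').1
        have := (hxy k hk).1
        omega
      intro hiff
      apply hch
      constructor
      · intro h; rcases hiff.mp (Or.inl h) with h' | h'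
        · exact h'
        · exact absurd h' hRw
      · intro h; rcases hiff.mpr (Or.inl h) with h' | h'
        · exact h'
        · exact absurd h' hRw'
  have hRsil : ∀ k, k < T → ∀ w, w ≤ n → ¬ (Rr (k + 1) w ↔ Rr k w) →
      (w = x k ∧ Lr k (x k) ∧ Rr k (y k) ∧ ∀ q, x k < q → q < y k → ¬ Lr k q ∧ ¬ Rr k q) ∨
        ¬ ((Lr (k + 1) w ∨ Rr (k + 1) w) ↔ (Lr k w ∨ Rr k w)) := by
    intro k hk w hw hch
    obtain ⟨hwx, ⟨hRy, hnoR⟩, -, hL⟩ := hRfl k hk w hw hch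
    by_cases hLw : Lr k w
    · left
      refine ⟨hwx, hwx ▸ hLw, hRy, fun q h1 h2 => ⟨hL (hwx ▸ hLw) q h1 h2, hnoR q h1 h2⟩⟩
    · right
      have hLw' : ¬ Lr (k + 1) w := by
        intro h
        have hch' : ¬ (Lr (k + 1) w ↔ Lr k w) := fun hiff => hLw (hiff.mp h)
        have := (hLfl k hk w hw hch').1
        have := (hxy k hk).1
        omega
      intro hiff
      apply hch
      constructor
      · intro h; rcases hiff.mp (Or.inr h) with h' | h'
        · exact absurd h' hLw
        · exact h'
      · intro h; rcases hiff.mpr (Or.inr h) with h' | h'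
        · exact absurd h' hLw'
        · exact h'
  -- order persistence of a pair that is not acted on
  have hpers : ∀ p q k₁ k₂, p ≤ n → q ≤ n → p < q → k₁ ≤ k₂ → k₂ ≤ T →
      (∀ k, k₁ ≤ k → k < k₂ → ¬ (x k = p ∧ y k = q)) → (S k₂ p < S k₂ q ↔ S k₁ p < S k₁ q) := by
    intro p q k₁ k₂ hp hq hpq hk hk2 hno
    refine iff_of_steps (P := fun k => S k p < S k q) hk (fun k h1 h2 => ?_)
    have hkT : k < T := by omega
    exact (hord k hkT p q hp hq (fun h => hno k h1 h2 ⟨h.1.symm, h.2.symm⟩)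
      (fun h => by have := (hxy k hkT).1; omega)).symm
  -- no event with right end `z` in `(t, s]`, none with right end `v'` in `(t', s]`
  have hnoRz : ∀ k, t < k → k ≤ s → (Lr k (x k) ∧ Rr k (y k) ∧ ∀ q, x k < q → q < y k → ¬ Lr k q ∧ ¬ Rr k q) →
      y k ≠ y t := by
    intro k hk1 hk2 hev hyk
    obtain ⟨hLx, -, hg⟩ := hev
    have hkT : k < T := by omega
    obtain ⟨hxk, -⟩ := hxy k hkT
    rcases Nat.lt_trichotomy (x k) (x t) with h | h | h
    · -- `u` lies in the gap of the event `k`, but is a record (frozen)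
      have h1 := hg (x t) h (by omega)
      have h2 := (hfr k hk1.le hk2 (x t) le_rfl huz.le).mpr (Or.inl hLu)
      exact h2.elim h1.1 h1.2
    · exact absurd (honce k hkT t (by omega) h hyk) (by omega)
    · -- `x k` lies in the frozen open gap `(u, z)`
      have h1 := hgap (x k) h (by omega)
      have h2 := (hfr k hk1.le hk2 (x k) h.le (by omega)).mp (Or.inl hLx)
      exact h2.elim h1.1 h1.2
  have hnoRv : ∀ k, t' < k → k ≤ s → (Lr k (x k) ∧ Rr k (y k) ∧ ∀ q, x k < q → q < y k → ¬ Lr k q ∧ ¬ Rr k q) →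
      y k ≠ y t' := by
    intro k hk1 hk2 hev hyk
    obtain ⟨hLx, -, hg⟩ := hev
    have hkT : k < T := by omega
    obtain ⟨hxk, -⟩ := hxy k hkT
    rcases Nat.lt_trichotomy (x k) (x t') with h | h | h
    · have h1 := hg (x t') h (by omega)
      have h2 := (hfr' k hk1.le hk2 (x t') le_rfl (by omega)).mpr (Or.inl (hzz ▸ hLz'))
      exact h2.elim h1.1 h1.2
    · exact absurd (honce k hkT t' (by omega) h hyk) (by omega)
    · have h1 := hgap' (x k) (by rw [← hzz]; exact h) (by omega)
      have h2 := (hfr' k hk1.le hk2 (x k) h.le (by omega)).mp (Or.inl hLx)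
      exact h2.elim h1.1 h1.2
  -- bits are constant on the frozen windows (after the event step)
  have hLz_const : ∀ k, t + 1 ≤ k → k < s → (Lr (k + 1) (y t) ↔ Lr k (y t)) := by
    intro k hk1 hk2
    by_contra hch
    rcases hLsil k (by omega) (y t) hzn hch with ⟨hwy, hev⟩ | hmem
    · exact hnoRz k (by omega) hk2.le hev hwy.symm
    · exact hmem ((hfr (k + 1) (by omega) (by omega) (y t) huz.le le_rfl).trans
        (hfr k (by omega) hk2.le (y t) huz.le le_rfl).symm)
  have hRz_const : ∀ k, t' + 1 ≤ k → k < s → (Rr (k + 1) (y t) ↔ Rr k (y t)) := by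
    intro k hk1 hk2
    by_contra hch
    rcases hRsil k (by omega) (y t) hzn hch with ⟨hwx, hev⟩ | hmem
    · exact hnx' k (by omega) hk2.le hev (by rw [hzz, hwx]) 
    · exact hmem ((hfr' (k + 1) (by omega) (by omega) (y t) (by omega) (by omega)).trans
        (hfr' k (by omega) hk2.le (y t) (by omega) (by omega)).symm)
  have hRu_const : ∀ k, t + 1 ≤ k → k < s → (Rr (k + 1) (x t) ↔ Rr k (x t)) := by
    intro k hk1 hk2
    by_contra hch
    rcases hRsil k (by omega) (x t) hun hch with ⟨hwx, hev⟩ | hmem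
    · exact hnx k (by omega) hk2.le hev hwx.symm
    · exact hmem ((hfr (k + 1) (by omega) (by omega) (x t) le_rfl huz.le).trans
        (hfr k (by omega) hk2.le (x t) le_rfl huz.le).symm)
  have hLv_const : ∀ k, t' + 1 ≤ k → k < s → (Lr (k + 1) (y t') ↔ Lr k (y t')) := by
    intro k hk1 hk2
    by_contra hch
    rcases hLsil k (by omega) (y t') hvn hch with ⟨hwy, hev⟩ | hmem
    · exact hnoRv k (by omega) hk2.le hev hwy.symm
    · exact hmem ((hfr' (k + 1) (by omega) (by omega) (y t') (by omega) le_rfl).trans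
        (hfr' k (by omega) hk2.le (y t') (by omega) le_rfl).symm)
  -- the event flips at `t` and `t'`
  obtain ⟨hfLz, hfRu, -, -⟩ := hEvf t (by omega) ⟨hLu, hRz, hgap⟩
  obtain ⟨hfLv, hfRz, -, hRv1⟩ := hEvf t' (by omega) ⟨hzz.symm ▸ hLz', hRv', fun q h1 h2 => hgap' q (by rw [← hzz]; exact h1) h2⟩
  rw [hzz] at hfRz
  rcases lt_or_gt_of_ne htt' with hlt | hlt
  · /- ### Case II: `t < t'` — the exit is a LEFT flip of `z` -/
    -- `z` is a left record from `t+1` to `s`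
    have hLz_s : Lr s (y t) := (iff_of_steps (P := fun k => Lr k (y t)) (show t' ≤ s by omega)
      (fun k h1 h2 => hLz_const k (by omega) h2)).mpr hLz'
    have hLz_t1 : Lr (t + 1) (y t) := (iff_of_steps (P := fun k => Lr k (y t)) (show t + 1 ≤ t' by omega)
      (fun k h1 h2 => hLz_const k h1 (by omega))).mp hLz'
    have hLz_t : ¬ Lr t (y t) := fun h => (hfLz.mp hLz_t1) h
    -- the exit at `s` is a left flip: `z = y s`, `x₀ = x s` its nearest left record
    have hchs : ¬ (Lr (s + 1) (y t) ↔ Lr s (y t)) := fun h => hexit.1 (h.mpr hLz_s)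
    obtain ⟨hzys, ⟨hLx0, hnox0⟩, -, -⟩ := hLfl s hsT (y t) hzn hchs
    obtain ⟨hx0z, -⟩ := hxy s hsT
    rw [← hzys] at hx0z hnox0
    -- `x₀ < u`
    have hx0u : x s < x t := by
      rcases Nat.lt_trichotomy (x s) (x t) with h | h | h
      · exact h
      · exact absurd (honce s hsT t (by omega) h hzys.symm) (by omega)
      · have h1 := hgap (x s) h hx0z
        have h2 := (hfr s hts.le le_rfl (x s) h.le hx0z.le).mp (Or.inl hLx0)
        exact (h2.elim h1.1 h1.2).elim
    have hLu_s : ¬ Lr s (x t) := hnox0 (x t) hx0u huz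
    have hRu_s : Rr s (x t) := by
      rcases (hfr s hts.le le_rfl (x t) le_rfl huz.le).mpr (Or.inl hLu) with h | h
      · exact absurd h hLu_s
      · exact h
    -- `u` is correct with respect to `x₀` at `s`
    have hgood_u : ¬ ((Even (x t + e) → S s (x t) < S s (x s)) ∧ (¬ Even (x t + e) → S s (x s) < S s (x t))) := by
      rw [← hSem s hsT.le (x s) (x t) hx0u hun hLx0 (fun q h1 h2 => hnox0 q h1 (by omega))]
      exact hLu_s
    -- the right bit of `u` is on at `t+1`, so the event at `t` was a creation
    have hRu_t1 : Rr (t + 1) (x t) := (iff_of_steps (P := fun k => Rr k (x t)) (show t + 1 ≤ s by omega)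
      (fun k h1 h2 => hRu_const k h1 h2)).mp hRu_s
    have hRu_t : ¬ Rr t (x t) := fun h => (hfRu.mp hRu_t1) h
    have hgz : ¬ ((Even (y t + e) → S t (y t) < S t (x t)) ∧ (¬ Even (y t + e) → S t (x t) < S t (y t))) := by
      rw [← hSem t (by omega) (x t) (y t) huz hzn hLu (fun q h1 h2 => (hgap q h1 h2).1)]
      exact hLz_t
    have hgu : ¬ ((Even (x t + e) → S t (x t) < S t (y t)) ∧ (¬ Even (x t + e) → S t (y t) < S t (x t))) := by
      rw [← hSemR t (by omega) (x t) (y t) huz hzn hRz (fun q h1 h2 => (hgap q h1 h2).2)]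
      exact hRu_t
    obtain ⟨hpar, hzE, hzO⟩ := parity_clash (hdis t (by omega) (y t) (x t) hzn hun (by omega)) hgz hgu
    -- heights at `s`: the pair flipped at `t` and never again
    have hper : S s (x t) < S s (y t) ↔ S (t + 1) (x t) < S (t + 1) (y t) :=
      hpers (x t) (y t) (t + 1) s hun hzn huz (by omega) hsT.le (fun k h1 h2 h =>
        absurd (honce k (by omega) t (by omega) h.1 h.2) (by omega))
    have hft := hflip t (by omega)
    have hzx0 := (hSem s hsT.le (x s) (y t) hx0z hzn hLx0 hnox0).mp hLz_s
    have hadj_u : S s (x t) < S s (x s) ↔ S s (x t) < S s (y t) := by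
      have := hadj s hsT (x t) hun (by omega) (by omega)
      rwa [← hzys] at this
    have hne_ux0 := hdis s hsT.le (x t) (x s) hun (by omega) (by omega)
    have hne_uz := hdis s hsT.le (x t) (y t) hun hzn (by omega)
    apply hgood_u
    by_cases hz : Even (y t + e)
    · have hu : ¬ Even (x t + e) := hpar.mp hz
      -- `z` above `u` at `t`, below from `t+1` on; `z` below `x₀` at `s`; so `x₀` above `u`
      have h1 : S s (y t) < S s (x t) := by
        have h2 : ¬ S (t + 1) (x t) < S (t + 1) (y t) := hft.mp (hzE hz)
        rw [← hper] at h2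
        exact lt_of_le_of_ne (not_lt.mp h2) (Ne.symm hne_uz)
      refine ⟨fun h => absurd h hu, fun _ => ?_⟩
      have h3 : ¬ S s (x t) < S s (x s) := fun h => lt_asymm h1 (hadj_u.mp h)
      exact lt_of_le_of_ne (not_lt.mp h3) (Ne.symm hne_ux0)
    · have hu : Even (x t + e) := by
        by_contra h
        exact hz (hpar.mpr h)
      have h1 : S s (x t) < S s (y t) := by
        have h2 : S t (y t) < S t (x t) := hzO hz
        have h3 : ¬ S t (x t) < S t (y t) := fun h => lt_asymm h h2
        have h4 : S (t + 1) (x t) < S (t + 1) (y t) := by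
          by_contra h5
          exact h3 (hft.mpr h5)
        exact hper.mpr h4
      exact ⟨fun _ => hadj_u.mpr h1, fun h => absurd hu h⟩
  · /- ### Case I: `t' < t` — the exit is a RIGHT flip of `z` -/
    -- `z` is a right record from `t'+1` to `s`
    have hRz_s : Rr s (y t) := (iff_of_steps (P := fun k => Rr k (y t)) hts.le
      (fun k h1 h2 => hRz_const k (by omega) h2)).mpr hRz
    have hRz_t1 : Rr (t' + 1) (y t) := (iff_of_steps (P := fun k => Rr k (y t)) (show t' + 1 ≤ t by omega)
      (fun k h1 h2 => hRz_const k h1 (by omega))).mp hRz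
    have hRz_t' : ¬ Rr t' (y t) := fun h => (hfRz.mp hRz_t1) h
    -- the exit at `s` is a right flip: `z = x s`, `y₀ = y s` its nearest right record
    have hchs : ¬ (Rr (s + 1) (y t) ↔ Rr s (y t)) := fun h => hexit.2 (h.mpr hRz_s)
    obtain ⟨hzxs, ⟨hRy0, hnoy0⟩, -, -⟩ := hRfl s hsT (y t) hzn hchs
    obtain ⟨hzy0, hy0n⟩ := hxy s hsT
    rw [← hzxs] at hzy0 hnoy0
    -- `y₀ > v'`
    have hy0v : y t' < y s := by
      rcases Nat.lt_trichotomy (y s) (y t') with h | h | h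
      · have h1 := hgap' (y s) hzy0 h
        have h2 := (hfr' s ht's.le le_rfl (y s) (by omega) h.le).mp (Or.inr hRy0)
        exact (h2.elim h1.1 h1.2).elim
      · exact absurd (honce s hsT t' (by omega) (by rw [← hzxs, hzz]) h) (by omega)
      · exact h
    have hRv_s : ¬ Rr s (y t') := hnoy0 (y t') hzv hy0v
    -- `v'` is then incorrect… first: `v'` lost its right bit at a left-event of its own, so it is a left record on `(t', s]`
    have hLv_t1 : Lr (t' + 1) (y t') := by
      -- some step in `[t'+1, s)` flips the right bit of `v'`
      have hch : ¬ (Rr (t' + 1) (y t') ↔ Rr s (y t')) := fun h => hRv_s (h.mp hRv1)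
      obtain ⟨k, hk1, hk2, hk3⟩ := exists_step_of_not_iff (P := fun τ => Rr τ (y t')) (show t' + 1 ≤ s by omega) hch
      have hk3' : ¬ (Rr (k + 1) (y t') ↔ Rr k (y t')) := fun h => hk3 h.symm
      rcases hRsil k (by omega) (y t') hvn hk3' with ⟨hwx, hev⟩ | hmem
      · have hLvk : Lr k (y t') := hwx ▸ hev.1
        exact (iff_of_steps (P := fun τ => Lr τ (y t')) hk1 (fun k' h1 h2 => hLv_const k' h1 (by omega))).mp hLvk
      · exact absurd ((hfr' (k + 1) (by omega) (by omega) (y t') (by omega) le_rfl).trans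
          (hfr' k (by omega) (by omega) (y t') (by omega) le_rfl).symm) hmem
    have hLv_t' : ¬ Lr t' (y t') := fun h => (hfLv.mp hLv_t1) h
    -- so `(z, v')` was a creation: opposite parities, `z` correct w.r.t. `v'` at `t'`
    have hgv : ¬ ((Even (y t' + e) → S t' (y t') < S t' (y t)) ∧ (¬ Even (y t' + e) → S t' (y t) < S t' (y t'))) := by
      rw [← hSem t' (by omega) (y t) (y t') hzv hvn hLz' (fun q h1 h2 => (hgap' q h1 h2).1)]
      exact hLv_t'
    have hgz : ¬ ((Even (y t + e) → S t' (y t) < S t' (y t')) ∧ (¬ Even (y t + e) → S t' (y t') < S t' (y t))) := by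
      rw [← hSemR t' (by omega) (y t) (y t') hzv hvn hRv' (fun q h1 h2 => (hgap' q h1 h2).2)]
      exact hRz_t'
    obtain ⟨hpar, hzE, hzO⟩ := parity_clash (hdis t' (by omega) (y t) (y t') hzn hvn (by omega)) hgz hgv
    -- heights at `s`: the pair `(z, v')` flipped at `t'` and never again
    have hper : S s (y t) < S s (y t') ↔ S (t' + 1) (y t) < S (t' + 1) (y t') :=
      hpers (y t) (y t') (t' + 1) s hzn hvn hzv (by omega) hsT.le (fun k h1 h2 h =>
        absurd (honce k (by omega) t' (by omega) (by rw [hzz]; exact h.1) h.2) (by omega))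
    have hft := hflip t' (by omega)
    rw [hzz] at hft
    have hzy0 := (hSemR s hsT.le (y t) (y s) hzy0 hy0n hRy0 hnoy0).mp hRz_s
    have hadj_v : S s (y t') < S s (y t) ↔ S s (y t') < S s (y s) := by
      have := hadj s hsT (y t') hvn (by omega) (by omega)
      rwa [← hzxs] at this
    have hne_vy0 := hdis s hsT.le (y t') (y s) hvn hy0n (by omega)
    have hne_vz := hdis s hsT.le (y t') (y t) hvn hzn (by omega)
    -- `v'` is incorrect with respect to `y₀` at `s`, hence a right record: contradiction
    apply hRv_s
    rw [hSemR s hsT.le (y t') (y s) hy0v hy0n hRy0 (fun q h1 h2 => hnoy0 q (by omega) h2)]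
    by_cases hz : Even (y t + e)
    · have hv : ¬ Even (y t' + e) := hpar.mp hz
      -- `z` above `v'` at `t'`, below from `t'+1` on; `z` below `y₀`; so `y₀ < v'`… no: `v'` above `z`, adjacent pair ⇒ `v'` above `y₀`
      have h1 : S s (y t) < S s (y t') := by
        have h2 : ¬ S t' (y t) < S t' (y t') := fun h => lt_asymm h (hzE hz)
        have h3 : S (t' + 1) (y t) < S (t' + 1) (y t') := by
          by_contra h4; exact h2 (hft.mpr h4)
        exact hper.mpr h3
      refine ⟨fun h => absurd h hv, fun _ => ?_⟩
      have h4 : ¬ S s (y t') < S s (y s) := fun h => lt_asymm h1 (hadj_v.mpr h)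
      exact lt_of_le_of_ne (not_lt.mp h4) (Ne.symm hne_vy0)
    · have hv : Even (y t' + e) := by
        by_contra h
        exact hz (hpar.mpr h)
      have h1 : S s (y t') < S s (y t) := by
        have h2 : S t' (y t) < S t' (y t') := hzO hz
        have h3 : ¬ S (t' + 1) (y t) < S (t' + 1) (y t') := hft.mp h2
        rw [← hper] at h3
        exact lt_of_le_of_ne (not_lt.mp h3) hne_vz
      exact ⟨fun _ => hadj_v.mp h1, fun h => absurd hv h⟩

end Cases

end StaticPathFold

end Summit.ValiantsHypothesis.ValiantsHypothesis.Theorems.KPlusLogSqLaw
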